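import Literature.AlgebraicGeometry.Motives.ZarhinHodgeGroupPositivity
import Literature.AlgebraicGeometry.Motives.ZarhinHodgeGroupUnitaryLie
import Literature.AlgebraicGeometry.Motives.HodgeStructureEndAlgDiagonalization
import HarnessLib

/-!
# The eigenspace blocks `T_σ` of the endomorphism field and Zarhin's Lie algebra theorem at the distinguished block (Zarhin's theorem, step 7)

Let `(H, ψ)` be an irreducible polarized `ℚ`-Hodge structure of K3 type on a finite-dimensional
`V`, `E = End_Hdg(V)` its endomorphism field (Huybrechts, *Lectures on K3 Surfaces*, Cor. 3.3.6,
the tree's proved `Zarhin1983_endAlg_isField_holds`). For a character `σ : E → ℂ` the **block**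
`T_σ = eigenBlock H σ ⊆ V_ℂ` (**definition**) is the simultaneous eigenspace on which every
`a ∈ E` acts by `σ(a)` (Huybrechts Rem. 3.3.14 (iii); van Geemen, *Real multiplication on K3
surfaces*, §2: "`V ⊗ ℂ = ⊕ V_σ`"). We prove:

* blocks are stable under the complexified Lie algebra `𝔥_ℂ = hodgeLieC H` of the Hodge group
  (`apply_mem_eigenBlock_of_mem_hodgeLieC`), conjugation sends `T_σ` to `T_σ̄`
  (`conj_mem_eigenBlock`), the blocks span `V_ℂ` (`iSup_eigenBlock_eq_top`), and
  `ψ_ℂ(T_σ, T_τ) = 0` unless `τ̄ = σ` (`form_eq_zero_of_mem_eigenBlock`, from Zarhin's theorem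
  `φ(a') = conj φ(a)`, the tree's proved `Zarhin1983_adjoint_eq_conj_holds`);
* the distinguished character `ε` (action on `V^{2,0}`) has `V^{2,0} ⊆ T_ε`, `V^{0,2} ⊆ T_ε̄`, and
  for `0 ≠ e ∈ V^{2,0}`, `f ∈ V^{0,2}` with `ψ_ℂ(e, f) = 1` the **Hodge element** satisfies
  `Θ = 2 e ∧ f`, so `e ∧ f ∈ 𝔥_ℂ` (`wedge_mem_hodgeLieC_of_generator`);
* **Zarhin's Lie algebra theorem at the distinguished block(s)**: in the totally real case
  (`ε̄ = ε`, every Hodge endomorphism self-adjoint) `x ∧ y ∈ 𝔥_ℂ` for all `x, y ∈ T_ε`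
  (`wedge_mem_hodgeLieC_of_mem_eigenBlock_eps`, from `ZarhinLie.wedge_mem_of_irreducible`), and in
  the CM case (`ε̄ ≠ ε`) `x ∧ y ∈ 𝔥_ℂ` for all `x ∈ T_ε`, `y ∈ T_ε̄`
  (`wedge_mem_hodgeLieC_of_mem_eigenBlock_eps_conj`, from
  `ZarhinLie.wedge_mem_of_irreducible_of_isotropic`), the irreducibility input being
  `eq_bot_or_forall_mem_of_hodgeLieC_stable` (positivity). This is `Lie(Hdg)_ℂ ⊇ so(T_ε)` resp.
  `⊇ gl(T_ε)` — the `σ₀`-component of Zarhin's "comparison of dimensions" (Zarhin 1983,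
  Thms. 2.2.1/2.3.1; Huybrechts Thm. 3.3.9); the other blocks follow by Galois transport
  (`ZarhinHodgeGroupTransport`).

The wedge `x ∧ y` is written out as `smulRight (ψ_ℂ y) x - smulRight (ψ_ℂ x) y`. One definition
(`eigenBlock`), no named facts.

## References

* D. Huybrechts, *Lectures on K3 Surfaces* (CUP 2016), Cor. 3.3.6, Thm. 3.3.7, Thm. 3.3.9,
  Rem. 3.3.14.
* Yu. G. Zarhin, *Hodge groups of K3 surfaces*, J. reine angew. Math. 341 (1983), §2.
* B. van Geemen, *Real multiplication on K3 surfaces and Kuga–Satake varieties*, Michigan Math.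
  J. 56 (2008), §2.
-/

noncomputable section

open scoped TensorProduct

namespace Literature.AlgebraicGeometry.Motives

namespace HodgeStructure

universe u

variable {V : Type u} [AddCommGroup V] [Module ℚ V] [Module.Finite ℚ V] [HodgeTensorFacts.{u, u}]
  {n : ℤ}

/-! ### Blocks -/

/-- **The block `T_σ ⊆ V_ℂ` of a character `σ : End_Hdg(V) → ℂ`**: the simultaneous eigenspace
`{x | a_ℂ x = σ(a) x for all a ∈ End_Hdg(V)}` (Huybrechts Rem. 3.3.14 (iii): "`T_ρ` is the
`ℂ`-subspace on which the elements `α ∈ K` act by multiplication with `ρ(α)`"; van Geemen §2).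
[cite: Huybrechts2016K3, Rem. 3.3.14 (iii)] -/
def eigenBlock (H : HodgeStructure V n) (σ : H.endAlg →+* ℂ) : Submodule ℂ (ℂ ⊗[ℚ] V) :=
  ⨅ a : H.endAlg, Module.End.eigenspace ((a : Module.End ℚ V).baseChange ℂ) (σ a)

omit [Module.Finite ℚ V] [HodgeTensorFacts.{u, u}] in
/-- Membership in a block: `a_ℂ x = σ(a) x` for all `a`. [cite: Huybrechts2016K3, Rem. 3.3.14 (iii)] -/
theorem mem_eigenBlock_iff (H : HodgeStructure V n) (σ : H.endAlg →+* ℂ) (x : ℂ ⊗[ℚ] V) :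
    x ∈ H.eigenBlock σ ↔ ∀ a : H.endAlg, (a : Module.End ℚ V).baseChange ℂ x = σ a • x := by
  simp only [eigenBlock, Submodule.mem_iInf, Module.End.mem_eigenspace_iff]

/-- **Blocks are `𝔥_ℂ`-stable**: `𝔥_ℂ` commutes with `E ⊗ ℂ`
(`commute_baseChange_of_mem_hodgeLieC`). [folklore] -/
theorem apply_mem_eigenBlock_of_mem_hodgeLieC (H : HodgeStructure V n) {σ : H.endAlg →+* ℂ}
    {Y : Module.End ℂ (ℂ ⊗[ℚ] V)} (hY : Y ∈ H.hodgeLieC) {x : ℂ ⊗[ℚ] V} (hx : x ∈ H.eigenBlock σ) :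
    Y x ∈ H.eigenBlock σ := by
  rw [mem_eigenBlock_iff] at hx ⊢
  intro a
  rw [← Module.End.mul_apply, ← H.commute_baseChange_of_mem_hodgeLieC hY a, Module.End.mul_apply,
    hx a, map_smul]

omit [Module.Finite ℚ V] [HodgeTensorFacts.{u, u}] in
/-- **Conjugation maps `T_σ` to `T_σ̄`**, `σ̄ = conj ∘ σ` (the `a_ℂ` are real operators).
[cite: Huybrechts2016K3, Rem. 3.3.14 (iii)] -/
theorem conj_mem_eigenBlock (H : HodgeStructure V n) {σ : H.endAlg →+* ℂ} {x : ℂ ⊗[ℚ] V}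
    (hx : x ∈ H.eigenBlock σ) : conj x ∈ H.eigenBlock ((starRingEnd ℂ).comp σ) := by
  rw [mem_eigenBlock_iff] at hx ⊢
  intro a
  rw [← conj_baseChange, hx a, conj_smul, RingHom.comp_apply]

omit [Module.Finite ℚ V] [HodgeTensorFacts.{u, u}] in
/-- `conj ∘ (conj ∘ σ) = σ`. [folklore] -/
theorem starRingEnd_comp_comp (H : HodgeStructure V n) (σ : H.endAlg →+* ℂ) :
    (starRingEnd ℂ).comp ((starRingEnd ℂ).comp σ) = σ := by
  ext a
  simp

omit [HodgeTensorFacts.{u, u}] in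
/-- **Orthogonality of blocks**: `ψ_ℂ(T_σ, T_τ) = 0` unless `τ̄ = σ`. For `x ∈ T_σ`, `y ∈ T_τ`
and an adjoint pair `(a, a')`: `σ(a) ψ_ℂ(x,y) = ψ_ℂ(a x, y) = ψ_ℂ(x, a' y) = τ(a') ψ_ℂ(x,y)` and
`τ(a') = conj τ(a)` by Zarhin's theorem (Huybrechts Thm. 3.3.7 / Rem. 3.3.14 (i),
`Zarhin1983_adjoint_eq_conj_holds`). [cite: Huybrechts2016K3, Thm. 3.3.7 and Rem. 3.3.14] -/
theorem form_eq_zero_of_mem_eigenBlock {H : HodgeStructure V 2} (hirr : H.IsIrreducible)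
    (hK3 : H.IsOfK3Type) (ψ : H.Polarization) {σ τ : H.endAlg →+* ℂ}
    (hστ : (starRingEnd ℂ).comp τ ≠ σ) {x y : ℂ ⊗[ℚ] V} (hx : x ∈ H.eigenBlock σ)
    (hy : y ∈ H.eigenBlock τ) : ψ.form.baseChange ℂ x y = 0 := by
  obtain ⟨a, ha⟩ : ∃ a : H.endAlg, starRingEnd ℂ (τ a) ≠ σ a := by
    by_contra h
    push Not at h
    exact hστ (RingHom.ext fun a => h a)
  obtain ⟨hex, hconj⟩ := Zarhin1983_adjoint_eq_conj_holds H hirr hK3 ψ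
  obtain ⟨a', hadj⟩ := hex a
  have h1 := isAdjointPair_baseChange hadj x y
  rw [(H.mem_eigenBlock_iff σ x).1 hx a, (H.mem_eigenBlock_iff τ y).1 hy a', hconj a a' hadj τ,
    map_smul, LinearMap.smul_apply, map_smul, smul_eq_mul, smul_eq_mul] at h1
  have h2 : (σ a - starRingEnd ℂ (τ a)) * ψ.form.baseChange ℂ x y = 0 := by rw [sub_mul, h1, sub_self]
  rcases mul_eq_zero.1 h2 with h | h
  · exact absurd (sub_eq_zero.1 h).symm ha
  · exact h

omit [HodgeTensorFacts.{u, u}] in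
/-- **The blocks span `V_ℂ`**: `V_ℂ = Σ_σ T_σ` (Huybrechts Rem. 3.3.14 (iii): `T ⊗ ℂ = ⊕ T_ρ`).
With a primitive element `θ` of the field `E` (`exists_forall_eq_aeval`), `V_ℂ = ⊕_μ Eig_μ(θ_ℂ)`
(`iSup_eigenspace_baseChange_eq_top`) and each eigenspace lies in the block of its character
(`exists_ringHom_forall_baseChange_apply_eq_smul`). [cite: Huybrechts2016K3, Rem. 3.3.14 (iii)] -/
theorem iSup_eigenBlock_eq_top {H : HodgeStructure V 2} (hirr : H.IsIrreducible) (hK3 : H.IsOfK3Type) :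
    ⨆ σ : H.endAlg →+* ℂ, H.eigenBlock σ = ⊤ := by
  have hF : IsField H.endAlg := (Zarhin1983_endAlg_isField_holds H hirr hK3).1
  obtain ⟨θ, hgen⟩ := exists_forall_eq_aeval hF
  rw [eq_top_iff, ← iSup_eigenspace_baseChange_eq_top hF θ]
  refine iSup_le fun μ => ?_
  by_cases hμ : Module.End.HasEigenvalue ((θ : Module.End ℚ V).baseChange ℂ) μ
  · obtain ⟨φ, -, hφ⟩ := exists_ringHom_forall_baseChange_apply_eq_smul θ hgen hμ
    refine le_iSup_of_le φ fun x hx => ?_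
    rw [mem_eigenBlock_iff]
    exact fun a => hφ a x hx
  · rw [Module.End.hasEigenvalue_iff, not_not] at hμ
    rw [hμ]
    exact bot_le

/-! ### The distinguished character `ε` and the Hodge element `e ∧ f` -/

section Eps

variable {H : HodgeStructure V 2}

omit [Module.Finite ℚ V] [HodgeTensorFacts.{u, u}] in
/-- **The distinguished character**: there is `ε : E → ℂ` with `V^{2,0} ⊆ T_ε`
(`IsOfK3Type.exists_epsAlgHom`: `a|_{V^{2,0}} = ε(a) · id`, Huybrechts §3.3.3). [cite: Huybrechts2016K3, §3.3.3] -/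
theorem exists_eps_piece_le_eigenBlock (hK3 : H.IsOfK3Type) :
    ∃ ε : H.endAlg →+* ℂ, H.piece 2 0 ≤ H.eigenBlock ε := by
  obtain ⟨ε, hε⟩ := hK3.exists_epsAlgHom
  refine ⟨ε.toRingHom, fun x hx => ?_⟩
  rw [mem_eigenBlock_iff]
  exact fun a => hε a x hx

omit [Module.Finite ℚ V] [HodgeTensorFacts.{u, u}] in
/-- `V^{0,2} = conj V^{2,0} ⊆ T_ε̄`. [cite: Huybrechts2016K3, §3.3.3] -/
theorem piece_zero_two_le_eigenBlock {ε : H.endAlg →+* ℂ} (hε : H.piece 2 0 ≤ H.eigenBlock ε) :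
    H.piece 0 2 ≤ H.eigenBlock ((starRingEnd ℂ).comp ε) := by
  intro x hx
  have h := H.conj_mem_eigenBlock (hε (conj_mem_piece H hx))
  rwa [conj_conj] at h

omit [HodgeTensorFacts.{u, u}] in
/-- **In the totally real case `ε̄ = ε`**: if every Hodge endomorphism is `ψ`-self-adjoint then
`conj ∘ ε = ε` (`ε(a) = ε(a') = conj ε(a)`, Zarhin; Huybrechts Thm. 3.3.7). [cite: Huybrechts2016K3, Thm. 3.3.7] -/
theorem starRingEnd_comp_eq_of_forall_isAdjointPair (hirr : H.IsIrreducible) (hK3 : H.IsOfK3Type)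
    (ψ : H.Polarization)
    (hself : ∀ a : H.endAlg,
      LinearMap.IsAdjointPair ψ.form ψ.form (a : Module.End ℚ V) (a : Module.End ℚ V))
    (ε : H.endAlg →+* ℂ) : (starRingEnd ℂ).comp ε = ε := by
  ext a
  exact ((Zarhin1983_adjoint_eq_conj_holds H hirr hK3 ψ).2 a a (hself a) ε).symm

omit [HodgeTensorFacts.{u, u}] in
/-- **In the CM case `ε̄ ≠ ε`**: if some Hodge endomorphism `a₀` is not `ψ`-self-adjoint then
`conj ∘ ε ≠ ε` for the distinguished (injective) character: `ε(a₀') = conj ε(a₀)` with `a₀' ≠ a₀`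
(Huybrechts Thm. 3.3.7, CM case). [cite: Huybrechts2016K3, Thm. 3.3.7] -/
theorem starRingEnd_comp_ne_of_not_isAdjointPair (hirr : H.IsIrreducible) (hK3 : H.IsOfK3Type)
    (ψ : H.Polarization) {a₀ : H.endAlg}
    (ha₀ : ¬ LinearMap.IsAdjointPair ψ.form ψ.form (a₀ : Module.End ℚ V) (a₀ : Module.End ℚ V))
    {ε : H.endAlg →+* ℂ} (hε : H.piece 2 0 ≤ H.eigenBlock ε) : (starRingEnd ℂ).comp ε ≠ ε := by
  intro h
  obtain ⟨hex, hconj⟩ := Zarhin1983_adjoint_eq_conj_holds H hirr hK3 ψ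
  obtain ⟨a₁, hadj⟩ := hex a₀
  -- `ε a₁ = conj (ε a₀) = ε a₀`, and `ε` is injective (`Zarhin1983_endAlg_isField_holds`)
  have h1 : ε a₁ = ε a₀ := by
    rw [hconj a₀ a₁ hadj ε]
    exact RingHom.congr_fun h a₀
  obtain ⟨-, ε', hε'inj, hε'⟩ := Zarhin1983_endAlg_isField_holds H hirr hK3
  -- `ε` and `ε'` agree (both are the scalar on the non-zero `V^{2,0}`)
  obtain ⟨ω, hω, hω0, -⟩ := hK3.exists_generator
  have hagree : ∀ a : H.endAlg, ε a = ε' a := fun a => by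
    have h2 := (H.mem_eigenBlock_iff ε ω).1 (hε hω) a
    rw [hε' a ω hω] at h2
    exact (smul_left_injective ℂ hω0 h2).symm
  have h3 : a₁ = a₀ := hε'inj (by rw [← hagree, ← hagree, h1])
  rw [h3] at hadj
  exact ha₀ hadj

/-- **The Hodge element.** For `0 ≠ e ∈ V^{2,0}` and `f ∈ V^{0,2}` with `ψ_ℂ(e, f) = 1`, the wedge
`e ∧ f : w ↦ ψ_ℂ(f, w) e - ψ_ℂ(e, w) f` is `½ Θ` (`+1` on `V^{2,0} = ℂ e`, `0` on `V^{1,1}`, `-1` on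
`V^{0,2} = ℂ f`; `h^{2,0} = h^{0,2} = 1`), hence lies in `𝔥_ℂ` (`mem_hodgeLieC_of_forall_piece`). In
Zarhin's notation this is the image of the generator of `Lie U(1)` (Huybrechts p. 66).
[cite: Huybrechts2016K3, §3.3.4 (p. 66)] -/
theorem wedge_mem_hodgeLieC_of_generator (hK3 : H.IsOfK3Type) (ψ : H.Polarization)
    {e f : ℂ ⊗[ℚ] V} (he : e ∈ H.piece 2 0) (he0 : e ≠ 0) (hf : f ∈ H.piece 0 2)
    (hef : ψ.form.baseChange ℂ e f = 1) :
    (LinearMap.smulRight (ψ.form.baseChange ℂ f) e - LinearMap.smulRight (ψ.form.baseChange ℂ e) f :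
      Module.End ℂ (ℂ ⊗[ℚ] V)) ∈ H.hodgeLieC := by
  obtain ⟨Θ, hΘ⟩ := exists_hodgeTheta H
  have hfe : ψ.form.baseChange ℂ f e = 1 := by rw [ψ.form_baseChange_comm, hef]
  have hee : ψ.form.baseChange ℂ e e = 0 := ψ.form_piece_piece (p := 2) (p' := 2) (by norm_num)
    (by simpa using he) (by simpa using he)
  have hff : ψ.form.baseChange ℂ f f = 0 := ψ.form_piece_piece (p := 0) (p' := 0) (by norm_num)
    (by simpa using hf) (by simpa using hf)
  have hf0 : f ≠ 0 := fun h => by rw [h, map_zero] at hef; exact zero_ne_one hef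
  -- `V^{2,0} = ℂ e`, `V^{0,2} = ℂ f`
  have h20 : ∀ x ∈ H.piece 2 0, ∃ c : ℂ, c • e = x := by
    intro x hx
    have hfr : Module.finrank ℂ (H.piece 2 0) = 1 := hK3.hodgeNumber_two_zero
    obtain ⟨c, hc⟩ := (finrank_eq_one_iff_of_nonzero' (⟨e, he⟩ : H.piece 2 0)
      (by simpa using he0)).1 hfr ⟨x, hx⟩
    exact ⟨c, by simpa using congrArg Subtype.val hc⟩
  have h02 : ∀ x ∈ H.piece 0 2, ∃ c : ℂ, c • f = x := by
    intro x hx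
    have hfr : Module.finrank ℂ (H.piece 0 2) = 1 := hK3.hodgeNumber_zero_two
    obtain ⟨c, hc⟩ := (finrank_eq_one_iff_of_nonzero' (⟨f, hf⟩ : H.piece 0 2)
      (by simpa using hf0)).1 hfr ⟨x, hx⟩
    exact ⟨c, by simpa using congrArg Subtype.val hc⟩
  -- `e ∧ f = ½ Θ` on every piece, hence everywhere
  set E : Module.End ℂ (ℂ ⊗[ℚ] V) := LinearMap.smulRight (ψ.form.baseChange ℂ f) e -
    LinearMap.smulRight (ψ.form.baseChange ℂ e) f with hEdef
  have hEapply : ∀ w, E w = ψ.form.baseChange ℂ f w • e - ψ.form.baseChange ℂ e w • f := fun w => by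
    simp [hEdef, LinearMap.smulRight_apply]
  have key : ∀ p, ∀ x ∈ H.piece p (2 - p), E x = ((2 : ℂ)⁻¹ • Θ) x := by
    intro p x hx
    rw [LinearMap.smul_apply, hΘ p x hx, smul_smul, hEapply]
    by_cases hp2 : p = 2
    · subst hp2
      obtain ⟨c, rfl⟩ := h20 x (by simpa using hx)
      rw [map_smul, map_smul, smul_eq_mul, smul_eq_mul, hfe, hee]
      norm_num
    by_cases hp0 : p = 0
    · subst hp0
      obtain ⟨c, rfl⟩ := h02 x (by simpa using hx)
      rw [map_smul, map_smul, smul_eq_mul, smul_eq_mul, hff, hef]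
      norm_num
    by_cases hp1 : p = 1
    · subst hp1
      have h1 : ψ.form.baseChange ℂ f x = 0 := ψ.form_piece_piece (p := 0) (p' := 1) (by norm_num)
        (by simpa using hf) (by simpa using hx)
      have h2 : ψ.form.baseChange ℂ e x = 0 := ψ.form_piece_piece (p := 2) (p' := 1) (by norm_num)
        (by simpa using he) (by simpa using hx)
      rw [h1, h2]
      norm_num
    · -- other pieces vanish for K3 type
      have habs : 2 < |p - (2 - p)| := by
        rcases le_or_gt 0 (p - (2 - p)) with h | h
        · rw [abs_of_nonneg h]
          omega
        · rw [abs_of_neg h]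
          omega
      have hbot : H.piece p (2 - p) = ⊥ := hK3.2 p (2 - p) habs
      rw [hbot, Submodule.mem_bot] at hx
      subst hx
      simp
  have hEΘ : E = (2 : ℂ)⁻¹ • Θ := by
    apply LinearMap.ext fun x => ?_
    have hx : x ∈ ⨆ p : ℤ, H.piece p (2 - p) := (iSup_piece_eq_top_holds H) ▸ Submodule.mem_top
    induction hx using Submodule.iSup_induction' with
    | mem p x hx => exact key p x hx
    | zero => simp
    | add x y _ _ hx hy => rw [map_add, map_add, hx, hy]
  rw [hEΘ]
  exact H.hodgeLieC.smul_mem _ (H.mem_hodgeLieC_of_forall_piece hΘ)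

omit [Module.Finite ℚ V] [HodgeTensorFacts.{u, u}] in
/-- **Existence of the Hodge pair**: there are `0 ≠ e ∈ V^{2,0}` and `f ∈ V^{0,2}` with
`ψ_ℂ(e, f) = 1` (`f = conj e / ψ_ℂ(e, conj e)`, the denominator non-zero by the second
Hodge–Riemann relation). [folklore] -/
theorem exists_hodgePair (hK3 : H.IsOfK3Type) (ψ : H.Polarization) :
    ∃ e f : ℂ ⊗[ℚ] V, e ∈ H.piece 2 0 ∧ e ≠ 0 ∧ f ∈ H.piece 0 2 ∧ ψ.form.baseChange ℂ e f = 1 := by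
  obtain ⟨e, he, he0, -⟩ := hK3.exists_generator
  have hne := ψ.form_conj_ne_zero (p := 2) (q := 0) (by norm_num) he he0
  refine ⟨e, (ψ.form.baseChange ℂ e (conj e))⁻¹ • conj e, he, he0,
    Submodule.smul_mem _ _ (conj_mem_piece H he), ?_⟩
  rw [map_smul, smul_eq_mul, inv_mul_cancel₀ hne]

end Eps

/-! ### Zarhin's Lie algebra theorem at the distinguished block(s) -/

section Main

variable {H : HodgeStructure V 2}

/-- The irreducibility hypothesis of the abstract block theorems, for a block `T_σ`: every
`𝔥_ℂ`-stable subspace of `T_σ` is `0` or `T_σ` (from positivity,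
`eq_bot_or_forall_mem_of_hodgeLieC_stable`). [cite: Zarhin1983HodgeGroupsK3, §2] -/
theorem eq_bot_or_eq_eigenBlock (ψ : H.Polarization) (σ : H.endAlg →+* ℂ)
    (U : Submodule ℂ (ℂ ⊗[ℚ] V)) (hUW : U ≤ H.eigenBlock σ)
    (hU : ∀ Y ∈ H.hodgeLieC, ∀ u ∈ U, Y u ∈ U) : U = ⊥ ∨ U = H.eigenBlock σ := by
  rcases eq_bot_or_forall_mem_of_hodgeLieC_stable ψ (fun a => σ a)
    (fun x hx a => (H.mem_eigenBlock_iff σ x).1 (hUW hx) a) hU with h | h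
  · exact Or.inl h
  · exact Or.inr (le_antisymm hUW fun x hx => h x ((H.mem_eigenBlock_iff σ x).1 hx))

/-- **Zarhin's Lie algebra theorem at the distinguished block, totally real case**
(`Lie(Hdg T)_ℂ ⊇ so(T_ε)`; Zarhin 1983, Thm. 2.2.1; Huybrechts Thm. 3.3.9, "comparison of
dimensions"): if every Hodge endomorphism is `ψ`-self-adjoint and `V^{2,0} ⊆ T_ε`, then for all
`x, y ∈ T_ε` the wedge `x ∧ y = ψ_ℂ(y, ·) x - ψ_ℂ(x, ·) y` lies in `𝔥_ℂ`. Assembled from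
`ZarhinLie.wedge_mem_of_irreducible` with `S = 𝔥_ℂ` (Lie-closed, `ψ_ℂ`-skew, block-preserving),
the Hodge element `e ∧ f ∈ 𝔥_ℂ` and irreducibility of `T_ε` (positivity).
[cite: Zarhin1983HodgeGroupsK3, Thm. 2.2.1] [cite: Huybrechts2016K3, Thm. 3.3.9] -/
theorem wedge_mem_hodgeLieC_of_mem_eigenBlock_eps (hirr : H.IsIrreducible) (hK3 : H.IsOfK3Type)
    (ψ : H.Polarization)
    (hself : ∀ a : H.endAlg,
      LinearMap.IsAdjointPair ψ.form ψ.form (a : Module.End ℚ V) (a : Module.End ℚ V))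
    {ε : H.endAlg →+* ℂ} (hε : H.piece 2 0 ≤ H.eigenBlock ε) {x y : ℂ ⊗[ℚ] V}
    (hx : x ∈ H.eigenBlock ε) (hy : y ∈ H.eigenBlock ε) :
    (LinearMap.smulRight (ψ.form.baseChange ℂ y) x - LinearMap.smulRight (ψ.form.baseChange ℂ x) y :
      Module.End ℂ (ℂ ⊗[ℚ] V)) ∈ H.hodgeLieC := by
  obtain ⟨e, f, he, he0, hf, hef⟩ := exists_hodgePair hK3 ψ
  have hreal := starRingEnd_comp_eq_of_forall_isAdjointPair hirr hK3 ψ hself ε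
  have hfW : f ∈ H.eigenBlock ε := by
    have h := piece_zero_two_le_eigenBlock hε hf
    rwa [hreal] at h
  refine ZarhinLie.wedge_mem_of_irreducible (B := ψ.form.baseChange ℂ) (S := H.hodgeLieC)
    (fun u v => ψ.form_baseChange_comm v u)
    (fun X hX Y hY => H.commutator_mem_hodgeLieC hX hY)
    (fun X hX u v => formBaseChange_skew_of_mem_hodgeLieC ψ hX u v)
    (ψ.form_piece_piece (p := 2) (p' := 2) (by norm_num) (by simpa using he) (by simpa using he))
    (ψ.form_piece_piece (p := 0) (p' := 0) (by norm_num) (by simpa using hf) (by simpa using hf))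
    hef (wedge_mem_hodgeLieC_of_generator hK3 ψ he he0 hf hef)
    (fun Y hY w hw => H.apply_mem_eigenBlock_of_mem_hodgeLieC hY hw) (hε he) hfW
    (fun U hUW hU => eq_bot_or_eq_eigenBlock ψ ε U hUW hU) hx hy

/-- **Zarhin's Lie algebra theorem at the distinguished blocks, CM case**
(`Lie(Hdg T)_ℂ ⊇ gl(T_ε)` acting contragrediently on `T_ε̄`; Zarhin 1983, Thm. 2.3.1; Huybrechts
Thm. 3.3.9, CM case): if some Hodge endomorphism is not `ψ`-self-adjoint and `V^{2,0} ⊆ T_ε`,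
then for all `x ∈ T_ε`, `y ∈ T_ε̄` the wedge `x ∧ y` lies in `𝔥_ℂ`. Assembled from
`ZarhinLie.wedge_mem_of_irreducible_of_isotropic`: `T_ε`, `T_ε̄` are isotropic and orthogonal to
all other blocks (`form_eq_zero_of_mem_eigenBlock`), which with non-degeneracy of `ψ_ℂ` and
`V_ℂ = Σ T_σ` gives the perfectness hypothesis. [cite: Zarhin1983HodgeGroupsK3, Thm. 2.3.1]
[cite: Huybrechts2016K3, Thm. 3.3.9] -/
theorem wedge_mem_hodgeLieC_of_mem_eigenBlock_eps_conj (hirr : H.IsIrreducible)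
    (hK3 : H.IsOfK3Type) (ψ : H.Polarization) {a₀ : H.endAlg}
    (ha₀ : ¬ LinearMap.IsAdjointPair ψ.form ψ.form (a₀ : Module.End ℚ V) (a₀ : Module.End ℚ V))
    {ε : H.endAlg →+* ℂ} (hε : H.piece 2 0 ≤ H.eigenBlock ε) {x y : ℂ ⊗[ℚ] V}
    (hx : x ∈ H.eigenBlock ε) (hy : y ∈ H.eigenBlock ((starRingEnd ℂ).comp ε)) :
    (LinearMap.smulRight (ψ.form.baseChange ℂ y) x - LinearMap.smulRight (ψ.form.baseChange ℂ x) y :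
      Module.End ℂ (ℂ ⊗[ℚ] V)) ∈ H.hodgeLieC := by
  obtain ⟨e, f, he, he0, hf, hef⟩ := exists_hodgePair hK3 ψ
  have hcm : (starRingEnd ℂ).comp ε ≠ ε := starRingEnd_comp_ne_of_not_isAdjointPair hirr hK3 ψ ha₀ hε
  have hcm' : (starRingEnd ℂ).comp ((starRingEnd ℂ).comp ε) ≠ (starRingEnd ℂ).comp ε := by
    rw [starRingEnd_comp_comp]; exact hcm.symm
  have hfW' : f ∈ H.eigenBlock ((starRingEnd ℂ).comp ε) := piece_zero_two_le_eigenBlock hε hf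
  have hfe : ψ.form.baseChange ℂ f e = 1 := by rw [ψ.form_baseChange_comm, hef]
  -- perfectness: `y ∈ T_ε̄` orthogonal to `e` and to `T_ε ∩ f^⊥` is orthogonal to everything
  have hperf : ∀ z ∈ H.eigenBlock ((starRingEnd ℂ).comp ε), ψ.form.baseChange ℂ e z = 0 →
      (∀ w ∈ H.eigenBlock ε, ψ.form.baseChange ℂ f w = 0 → ψ.form.baseChange ℂ z w = 0) → z = 0 := by
    intro z hz hze hzw
    refine ψ.eq_zero_of_forall_form_eq_zero fun w => ?_
    have hw : w ∈ ⨆ σ : H.endAlg →+* ℂ, H.eigenBlock σ := (iSup_eigenBlock_eq_top hirr hK3) ▸ Submodule.mem_top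
    induction hw using Submodule.iSup_induction' with
    | mem σ w hw =>
      by_cases hσ : σ = ε
      · subst hσ
        -- `w = ψ(w,f) e + (w - ψ(w,f) e)` with the second summand in `T_ε ∩ f^⊥`
        have hw' : w - ψ.form.baseChange ℂ w f • e ∈ H.eigenBlock σ :=
          Submodule.sub_mem _ hw (Submodule.smul_mem _ _ (hε he))
        have hwf : ψ.form.baseChange ℂ f (w - ψ.form.baseChange ℂ w f • e) = 0 := by
          rw [map_sub, map_smul, smul_eq_mul, hfe, mul_one, ψ.form_baseChange_comm f w, sub_self]
        have h1 := hzw _ hw' hwf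
        rw [map_sub, map_smul, smul_eq_mul, ψ.form_baseChange_comm e z, hze, mul_zero, sub_zero] at h1
        exact h1
      · refine form_eq_zero_of_mem_eigenBlock hirr hK3 ψ (σ := (starRingEnd ℂ).comp ε) (τ := σ)
          (fun h => hσ ?_) hz hw
        rw [← starRingEnd_comp_comp H σ, h, starRingEnd_comp_comp]
    | zero => simp
    | add w w' _ _ hw hw' => rw [map_add, hw, hw', add_zero]
  refine ZarhinLie.wedge_mem_of_irreducible_of_isotropic (B := ψ.form.baseChange ℂ)
    (S := H.hodgeLieC) (fun u v => ψ.form_baseChange_comm v u)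
    (fun X hX Y hY => H.commutator_mem_hodgeLieC hX hY)
    (fun X hX u v => formBaseChange_skew_of_mem_hodgeLieC ψ hX u v)
    hef (wedge_mem_hodgeLieC_of_generator hK3 ψ he he0 hf hef)
    (fun Y hY w hw => H.apply_mem_eigenBlock_of_mem_hodgeLieC hY hw)
    (fun Y hY w hw => H.apply_mem_eigenBlock_of_mem_hodgeLieC hY hw)
    (fun u hu v hv => form_eq_zero_of_mem_eigenBlock hirr hK3 ψ hcm hu hv)
    (fun u hu v hv => form_eq_zero_of_mem_eigenBlock hirr hK3 ψ hcm' hu hv)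
    (hε he) hfW' hperf (fun U hUW hU => eq_bot_or_eq_eigenBlock ψ ε U hUW hU) hx hy

end Main

end HodgeStructure

end Literature.AlgebraicGeometry.Motives

end
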